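import Summits.Ventures.DiscreteObjects.PP12.FanoFiveKernelSearch

/-!
# PP(12), order 5: kernel runs of `Kernel.search` on orbit representatives, part H (kernel facts by `decide +kernel`)
Framing: lottery ticket; floor = certified bounds/negative ranges.

Cell pub-namedobj (venture DiscreteObjects), target (M), designs gen 18. For the representatives `R` of `Kernel.reps` with indices [11] this file establishes
`Kernel.search 45 ([0, 95, 63] ++ R) Cert.W4 9 = true` in the kernel (node counts from the exact Python mirror pub-namedobj-designs-g18/code/wc3lean.py +
split.py; this part = 511 search nodes, ≈ 0.1 s per node on the farm). Measured limits: one Lean process hits `(kernel) excessive memory consumption` after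
≈ 1,400 search nodes in total (cumulative over the file), so the 6,221 nodes of the 17 representatives are spread over eight files of ≤ ≈ 850 nodes, and a single
run above 380 nodes is SPLIT at its root into its two children (`splitH` = one unfolding of `Kernel.search`; the node's bookkeeping by cheap `decide`s).
With `Kernel.search_sound` (`FanoFiveKernelSearchSound`) each run refutes every word code whose weight-2 part is `R`; the assembly over all representatives is
`FanoFiveOrderFiveKernel`. No `sorry`, no new axioms; `maxHeartbeats` raised as in the UnitDistance kernel searches.
-/

namespace Summit.Ventures.DiscreteObjects.PP12

namespace FanoFive

namespace Kernel

open Cert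

/-- splitting a run at its root (this file's copy): the node's own bookkeeping — viable candidates `via`, branching candidate `c` — by cheap
`decide`s, and the two children runs, give the parent run (one unfolding of `Kernel.search`; lets every `decide +kernel` below stay under the kernel's
memory bound, ≈ 400 search nodes) -/
theorem splitH {f k : ℕ} {ws cands via rest : List ℕ} {c : ℕ}
    (hvia : (cands.filter fun d => okAdd (ents ws) ws d) = via) (hpick : pick (classes (ents ws) ws via) via = c :: rest) (hc : c ∈ via)
    (h1 : search f (ws ++ [c]) (via.erase c) k = true) (h2 : search f ws (via.erase c) (k + 1) = true) :
    search (f + 1) ws cands (k + 1) = true := by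
  rw [search]
  unfold node step
  rw [hvia]
  by_cases hl : via.length < k + 1
  · rw [if_pos hl]
  · rw [if_neg hl]
    unfold branch
    by_cases hs : short (classes (ents ws) ws via) = true
    · rw [if_pos hs]
    · rw [if_neg hs, hpick]
      simp only [hc, if_true, h1, h2, Bool.and_self]

set_option maxHeartbeats 4000000 in
/-- KERNEL FACT (179 search nodes in the Python mirror). -/
theorem run_12_24_33_66i : search 44 [0, 95, 63, 12, 24, 33, 66, 51] [15, 23, 27, 29, 30, 39, 43, 45, 46, 53, 54, 57, 58, 60, 71, 75, 77, 78, 83, 85, 86, 89, 90, 92, 99, 101, 102, 105, 106, 108, 113, 114, 116, 120] 8 = true := by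
  decide +kernel

set_option maxHeartbeats 4000000 in
/-- KERNEL FACT (331 search nodes in the Python mirror). -/
theorem run_12_24_33_66o : search 44 [0, 95, 63, 12, 24, 33, 66] [15, 23, 27, 29, 30, 39, 43, 45, 46, 53, 54, 57, 58, 60, 71, 75, 77, 78, 83, 85, 86, 89, 90, 92, 99, 101, 102, 105, 106, 108, 113, 114, 116, 120] 9 = true := by
  decide +kernel

/-- SPLIT NODE (511 search nodes below it in the Python mirror): from its two children by one unfolding of `Kernel.search`. -/
theorem run_12_24_33_66 : search 45 ([0, 95, 63] ++ [12, 24, 33, 66]) W4 9 = true :=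
  splitH (f := 44) (k := 8) (via := [15, 23, 27, 29, 30, 39, 43, 45, 46, 51, 53, 54, 57, 58, 60, 71, 75, 77, 78, 83, 85, 86, 89, 90, 92, 99, 101, 102, 105, 106, 108, 113, 114, 116, 120]) (c := 51) (rest := [83, 99, 113, 114])
    (by decide +kernel) (by decide +kernel) (by decide +kernel) run_12_24_33_66i run_12_24_33_66o

end Kernel

end FanoFive

end Summit.Ventures.DiscreteObjects.PP12
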